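import Summits.QuantumFields.BalabanUV.T4Continuum.Support.VariationalVectorWeitzenbock
import Summits.QuantumFields.BalabanUV.T4Continuum.Support.VariationalVectorExterior

/-!
# T⁴ programme, spine node NE2 (U1a), lane P2 — LEAF V-GF, file 1: BAŁABAN's PROJECTED GAUGE FUNCTIONAL IN THE ROAD's FUNCTION WORLD
# `projG R K W = ‖Π_{div_R D_R (K)} (div_R W)‖²_{ℓ²}` and THE GAUGE MOVE TO ITS ZERO SET (any transports): existence, the slice equation,
# uniqueness modulo `ker (div_R D_R)|_K`, transversality; the gauge directions `D_R λ` (curl = plaquette commutator, flat invariances) — model level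

NE2 formalisation swarm `b2b-balaban-t4-ne2-formalise-*`, leaf prover 09 GEN 7 (`prover-b2b-balaban-t4-ne2-formalise-leaf-09-g7-0`); journal INTENT
CLAIMS.log 2026-08-20 14:4xZ «V-GF AT U = 1».  Skeleton `t4/skeletons/NE2-t4-ne2-p2.md` v0.15 §2.E (decisions (D1)–(D2): the vector form
`ScV R G = n^{−d}·n²·(½curlSq R + G)` with a DATA gauge functional `G`); this lineage's design note of record (gen 6, `VariationalAssemblySlice` p220652):
the END needs `G` to satisfy (SLICE) — its zero set reachable INSIDE every fibre of the average at curl-cost `σ′·curl + σ·size` — and (GF3) (coercivity);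
the Landau inhabitant fails (SLICE); the printed candidate is [Balaban1984PropagatorsI] (1.46) ∕ (1.69)–(1.70): `R = I − P` applied to `∂*A`.  On top of
`VariationalVectorWeitzenbock.{divV, divSq}` (p218860), `VariationalColourBochner.{negLapv, ipv_DirAdjv}` (p215065), `VariationalColourFederbush.{cDv, Qcv}`
(p214930), `VariationalVectorForm.{cdV, curlV, curlSq}` (p216339), `VectorLineTransport.QvL` (p216509), `VariationalVectorExterior.QvL_cDv_flat` (p218348) — BY NAME.

THE OBJECT (model level; `E` a finite-dimensional complex Hilbert space; bond transports `R` and a submodule `K` of 0-forms are DATA).  With the covariant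
gradient `D_R` (`gradOp`), divergence `div_R` (`divOp`) and `div_R ∘ D_R` (`lapOp` = the colour Bochner Laplacian `negLapv`, `rfl`), let
`S_R(K) := div_R D_R (K)` read in `ℓ²` (`sliceSub`, a submodule of `PiLp 2`) and
  **`projG R K W := ‖Π_{S_R(K)} (div_R W)‖²`**, `Π_S` the `ℓ²`-orthogonal projection (`Submodule.starProjection`; finite dimension).
At `R = 1`, `K = ker Q′_k` this is the function-world form of (1.46) «δ(Q_kλ)·δ_R(∂*A − Δλ)»: `R∘Δ = Δ` on `N(Q_k)` with Jacobian `det(Δ↾N(Q_k))`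
forces `range R = Δ(N(Q_k))`, and (1.70)'s `I − P`, `P = Δ⁻¹Q′*(Q′Δ⁻²Q′*)⁻¹Q′Δ⁻¹` (p. 26), IS `Π_{Δ(ker Q′)}` by the abstract dictionary `(G⁻¹K)ᗮ = G(Kᗮ)`
(file 2 §5) — a READING of the printed formulas; the matrix-world bridge to `B5Value126.PcT` is NOT made here.
 * §1 gauge directions: `gradOp`, `avgOp` (`Qcv` bundled), **`curlV_cDv`** `(curl_R D_Rλ)_{μν}(x) = R(x,μ)R(x+e_μ,ν)λ(x+e_μ+e_ν) − R(x,ν)R(x+e_ν,μ)λ(x+e_ν+e_μ)`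
   (the plaquette commutator), `curlV_cDv_flat` (`= 0` at `U = 1`), **`curlSq_sub_cDv_flat`** (`curlSq 1 (W − D_1λ) = curlSq 1 W`), `QvL_sub`, `lineT_flat`,
   **`QvL_cDv_flat_eq_zero`** (`Q′_1λ = 0 ⟹ Q_1(D_1λ) = 0`, from `QvL_cDv_flat` = (1.19)/(1.55) «Q_k∂ = ∂₁Q_k» SHAPE);
 * §2 `divOp`, `lapOp` (`lapOp_eq_negLapv`), `divV_sub`, the slice subspace `sliceSub` (`mem_sliceSub`, `toLp_lapOp_mem`);
 * §3 `projG`: (GF0) `projG_nonneg`, `continuous_projG`, (GF1)-shape **`projG_le_divSq`** (`≤ divSq ≤ d·rough` for unitary `R` by p218860);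
   **`exists_gauge_projG_eq_zero`**: `∀ W ∃ λ ∈ K, projG R K (W − D_Rλ) = 0` (ANY transports — `Π_S(div_R W) ∈ S` is attained);
   `projG_sub_gradient_eq_zero_iff` (the slice equation `div_R D_R λ = Π_S(div_R W)`), **`lapOp_eq_of_projG_eq_zero`** (uniqueness modulo `ker(div_R D_R)↾K`),
   **`projG_gradient_eq_divSq`** (transversality: on `D_R(K)` the functional is the FULL divergence form), `cDv_eq_zero_of_lapOp_eq_zero`
   (`div_R D_Rλ = 0 ⟹ D_Rλ = 0`, by `⟪λ, div_R D_Rλ⟫ = Σ_μ‖D_μλ‖²`).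
File 2 (`VariationalVectorGaugeSliceFlat`): (SLICE) at `U = 1` with `σ′ = σ = 0` in the bracket's letters, uniqueness of the slice point, the dictionary.
NOT HERE: (GF3) for `projG` (= [B5] (1.90), the `n`-uniform coercivity — matrix world `B5DeltaA169`, unbridged); the END's structural binders `hGm`∕`hG`∕`hGtr`
for `projG` (matrix form, `sites`-transport — leaf-10-g3's Landau pattern); background (`σ′, σ = O(p)`: the constraint is then preserved only up to FED⁺'s mismatch).

HONEST FRAMING (T4-DAG p. 1).  Linear algebra about OUR typed objects at MODEL level; transports and `K` are DATA (no identification with Bałaban's `U(Γ)` — c5);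
the identification with (1.46)∕(1.70) is a reading, not kernel; [folklore]; nothing printed is a hypothesis; data `def`s `gradOp`, `avgOp`, `divOp`, `lapOp`,
`sliceSub`, `projG` only, no `def … : Prop`, no `sorry`; axioms standard.  V-GF with background OPEN; V-END ∕ NE2 NOT proved; NE3 OPEN; spine PROVED 0∕9
unchanged; rung (B)+1 finite T⁴ — NOT infinite volume, NOT mass gap, NOT Clay.  HONEST DEPENDENCY (cell, verbatim): continuum YM on T⁴ ⇐ BetaPertH ∧ nine
spine estimates (0/9 proved); BetaPertH ⇐ (D1) ∧ (D4) ∧ CAP+tail; G-an2-4 gates asym, D1 and NE2/3/4.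
-/

noncomputable section

namespace Summit.QuantumFields.BalabanUV.T4Continuum.VariationalVectorGaugeSlice

open Finset WithLp
open scoped InnerProductSpace
open Literature.MathematicalPhysics.QuantumFieldTheory.Balaban1983to89.B5Prop11Plancherel (Tor fine unitVec)
open Literature.MathematicalPhysics.QuantumFieldTheory.Balaban1983to89.B5Block118 (tstep bpt)
open Summit.QuantumFields.BalabanUV.T4Continuum.VariationalColourFederbush (cDv Qcv)
open Summit.QuantumFields.BalabanUV.T4Continuum.VariationalColourBochner (DirAdjv Dirv negLapv nsqv nsqv_nonneg ipv ipv_self ipv_sum_right ipv_DirAdjv)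
open Summit.QuantumFields.BalabanUV.T4Continuum.VariationalVectorWeitzenbock (divV divSq divV_apply divSq_nonneg)
open Summit.QuantumFields.BalabanUV.T4Continuum.VariationalVectorForm (cdV curlV curlSq ScV qWV curlSq_nonneg)
open Summit.QuantumFields.BalabanUV.T4Continuum.VectorBlockTrialForm (QvL nsqV)
open Summit.QuantumFields.BalabanUV.T4Continuum.VariationalVectorFederbush (lineT piTv_one)
open Summit.QuantumFields.BalabanUV.T4Continuum.VariationalVectorExterior (QvL_cDv_flat)

variable {d : ℕ} (N : Fin d → ℕ)
variable {E : Type*} [NormedAddCommGroup E]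

/-! ## §1 Gauge directions: the covariant gradient as a linear map, the curl of a gradient = the plaquette commutator, flat invariances -/

section Gauge

variable [NormedSpace ℂ E]

/-- the covariant gradient `D_R` of `E`-valued 0-forms as a `ℂ`-linear map (`VariationalColourFederbush.cDv` bundled). [folklore] -/
def gradOp (R : Tor N → Fin d → (E →L[ℂ] E)) : (Tor N → E) →ₗ[ℂ] (Tor N → Fin d → E) where
  toFun := cDv N R
  map_add' f g := by
    funext y μ
    simp only [cDv, Pi.add_apply, map_add]
    abel
  map_smul' c f := by
    funext y μ
    simp only [cDv, Pi.smul_apply, map_smul, RingHom.id_apply, smul_sub]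

/-- `gradOp R f = D_R f`. [folklore] -/
@[simp] theorem gradOp_apply (R : Tor N → Fin d → (E →L[ℂ] E)) (f : Tor N → E) : gradOp N R f = cDv N R f := rfl

/-- the covariant difference is subtractive in the 1-form. [folklore] -/
theorem cdV_sub (R : Tor N → Fin d → (E →L[ℂ] E)) (W W' : Tor N → Fin d → E) (x : Tor N) (μ ν : Fin d) :
    cdV N R (W - W') x μ ν = cdV N R W x μ ν - cdV N R W' x μ ν := by
  simp only [cdV, Pi.sub_apply, map_sub]
  abel

/-- **THE CURL OF A COVARIANT GRADIENT IS THE PLAQUETTE COMMUTATOR applied to the field at the far corner**: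
`(curl_R D_R λ)_{μν}(x) = R(x,μ)R(x+e_μ,ν) λ(x+e_μ+e_ν) − R(x,ν)R(x+e_ν,μ) λ(x+e_ν+e_μ)` (the first-order terms cancel in pairs). [folklore] -/
theorem curlV_cDv (R : Tor N → Fin d → (E →L[ℂ] E)) (f : Tor N → E) (x : Tor N) (μ ν : Fin d) :
    curlV N R (cDv N R f) x μ ν
      = R x μ (R (x + unitVec N μ) ν (f (x + unitVec N μ + unitVec N ν))) - R x ν (R (x + unitVec N ν) μ (f (x + unitVec N ν + unitVec N μ))) := by
  simp only [curlV, cdV, cDv, map_sub]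
  abel

/-- **AT `U = 1` A GRADIENT HAS ZERO CURL**: `curl_1 (D_1 λ) = 0`. [folklore] -/
theorem curlV_cDv_flat (f : Tor N → E) (x : Tor N) (μ ν : Fin d) :
    curlV N (fun _ _ => (1 : E →L[ℂ] E)) (cDv N (fun _ _ => (1 : E →L[ℂ] E)) f) x μ ν = 0 := by
  rw [curlV_cDv, add_right_comm x (unitVec N μ) (unitVec N ν)]
  simp only [one_apply_eq_self, sub_self]

/-- **AT `U = 1` THE CURL FORM IS GAUGE INVARIANT**: `curlSq 1 (W − D_1 λ) = curlSq 1 W`. [folklore] -/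
theorem curlSq_sub_cDv_flat [∀ μ, NeZero (N μ)] (W : Tor N → Fin d → E) (f : Tor N → E) :
    curlSq N (fun _ _ => (1 : E →L[ℂ] E)) (W - cDv N (fun _ _ => (1 : E →L[ℂ] E)) f) = curlSq N (fun _ _ => (1 : E →L[ℂ] E)) W := by
  unfold curlSq
  refine sum_congr rfl fun x _ => sum_congr rfl fun μ _ => sum_congr rfl fun ν _ => ?_
  -- `curl_R(W − V) = curl_R W − curl_R V` (also `VariationalVectorOneStepRepair.curlV_sub`, not imported to keep the cone small), then `curl_1 D_1 = 0`
  have h : curlV N (fun _ _ => (1 : E →L[ℂ] E)) (W - cDv N (fun _ _ => (1 : E →L[ℂ] E)) f) x μ ν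
      = curlV N (fun _ _ => (1 : E →L[ℂ] E)) W x μ ν - curlV N (fun _ _ => (1 : E →L[ℂ] E)) (cDv N (fun _ _ => (1 : E →L[ℂ] E)) f) x μ ν := by
    simp only [curlV, cdV_sub]
    abel
  rw [h, curlV_cDv_flat, sub_zero]

variable (n : ℕ) [NeZero n] (M : Fin d → ℕ) [hM : ∀ μ, NeZero (M μ)]

omit [NeZero n] hM in
/-- the transported block average `Q_{T′}` of `E`-valued fine 0-forms as a `ℂ`-linear map (`VariationalColourFederbush.Qcv` bundled). [folklore] -/
def avgOp (T' : Tor (fine n M) → (E →L[ℂ] E)) : (Tor (fine n M) → E) →ₗ[ℂ] (Tor M → E) where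
  toFun := Qcv n M T'
  map_add' f g := by
    funext y
    simp only [Qcv, Pi.add_apply, map_add, sum_add_distrib, smul_add]
  map_smul' c f := by
    funext y
    simp only [Qcv, Pi.smul_apply, map_smul, RingHom.id_apply, smul_sum, smul_comm c]

omit [NeZero n] hM in
/-- `avgOp T′ f = Q_{T′} f`. [folklore] -/
@[simp] theorem avgOp_apply (T' : Tor (fine n M) → (E →L[ℂ] E)) (f : Tor (fine n M) → E) : avgOp n M T' f = Qcv n M T' f := rfl

omit [NeZero n] hM in
/-- the line-sum average is subtractive in the 1-form. [folklore] -/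
theorem QvL_sub (T : Tor M → (Fin d → Fin n) → Fin n → Fin d → (E →L[ℂ] E)) (W W' : Tor (fine n M) → Fin d → E) :
    QvL n M T (W - W') = QvL n M T W - QvL n M T W' := by
  funext y μ
  simp only [QvL, Pi.sub_apply, map_sub, sum_sub_distrib, smul_sub]

omit [NeZero n] hM in
/-- flat product line transports are the identity transports: `lineT 1 1 = 1`. [folklore] -/
theorem lineT_flat : lineT n M (fun _ => (1 : E →L[ℂ] E)) (fun _ _ => (1 : E →L[ℂ] E)) = fun _ _ _ _ => 1 := by
  funext y j t ν
  simp only [lineT, piTv_one, mul_one]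

omit hM in
/-- **AT `U = 1` THE LINE-SUM AVERAGE IS BLIND TO GRADIENTS OF BLOCK-MEAN-FREE 0-FORMS**: `Q′_1 λ = 0 ⟹ Q_1(D_1 λ) = 0` — by leaf-01-g5's
`VariationalVectorExterior.QvL_cDv_flat` (`Q_1(D_1λ) = n⁻¹ • D_1(Q′_1 λ)`, [Balaban1984PropagatorsI] (1.19) SHAPE). [folklore] -/
theorem QvL_cDv_flat_eq_zero {f : Tor (fine n M) → E} (hf : Qcv n M (fun _ => (1 : E →L[ℂ] E)) f = 0) :
    QvL n M (lineT n M (fun _ => (1 : E →L[ℂ] E)) (fun _ _ => (1 : E →L[ℂ] E))) (cDv (fine n M) (fun _ _ => (1 : E →L[ℂ] E)) f) = 0 := by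
  funext y μ
  rw [QvL_cDv_flat, hf]
  simp only [cDv, Pi.zero_apply, map_zero, sub_self, smul_zero]

omit hM in
/-- the same for a 0-form whose block mean is CONSTANT (`D_1` of a constant vanishes). [folklore] -/
theorem QvL_cDv_flat_eq_zero_of_const {f : Tor (fine n M) → E} {c : E} (hf : Qcv n M (fun _ => (1 : E →L[ℂ] E)) f = fun _ => c) :
    QvL n M (lineT n M (fun _ => (1 : E →L[ℂ] E)) (fun _ _ => (1 : E →L[ℂ] E))) (cDv (fine n M) (fun _ _ => (1 : E →L[ℂ] E)) f) = 0 := by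
  funext y μ
  rw [QvL_cDv_flat, hf]
  simp only [cDv, one_apply_eq_self, sub_self, smul_zero, Pi.zero_apply]

end Gauge

/-! ## §2 The divergence and `div_R ∘ D_R` as linear maps; the SLICE SUBSPACE `div_R D_R (K)` in `ℓ²` -/

section Linear

variable [InnerProductSpace ℂ E] [CompleteSpace E]

/-- the covariant divergence `div_R` of `E`-valued 1-forms as a `ℂ`-linear map (`VariationalVectorWeitzenbock.divV` bundled). [folklore] -/
def divOp (R : Tor N → Fin d → (E →L[ℂ] E)) : (Tor N → Fin d → E) →ₗ[ℂ] (Tor N → E) where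
  toFun := divV N R
  map_add' W W' := by
    funext x
    simp only [divV_apply, Pi.add_apply, map_add, ← sum_add_distrib]
    exact sum_congr rfl fun μ _ => by abel
  map_smul' c W := by
    funext x
    simp only [divV_apply, Pi.smul_apply, map_smul, RingHom.id_apply, smul_sub, smul_sum]

/-- `divOp R W = div_R W`. [folklore] -/
@[simp] theorem divOp_apply (R : Tor N → Fin d → (E →L[ℂ] E)) (W : Tor N → Fin d → E) : divOp N R W = divV N R W := rfl

/-- the 0-form operator `div_R ∘ D_R` as a linear map. [folklore] -/
def lapOp (R : Tor N → Fin d → (E →L[ℂ] E)) : (Tor N → E) →ₗ[ℂ] (Tor N → E) := (divOp N R).comp (gradOp N R)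

/-- `lapOp R f = div_R (D_R f)`. [folklore] -/
theorem lapOp_apply (R : Tor N → Fin d → (E →L[ℂ] E)) (f : Tor N → E) : lapOp N R f = divV N R (cDv N R f) := rfl

/-- `lapOp R f` IS the colour Bochner file's covariant Laplacian `negLapv R f = Σ_μ D_μ†D_μ f` (`VariationalColourBochner`, p215065) — definitionally. [folklore] -/
theorem lapOp_eq_negLapv (R : Tor N → Fin d → (E →L[ℂ] E)) (f : Tor N → E) : lapOp N R f = negLapv N R f := rfl

/-- the divergence is subtractive: `div_R (W − W′) = div_R W − div_R W′`. [folklore] -/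
theorem divV_sub (R : Tor N → Fin d → (E →L[ℂ] E)) (W W' : Tor N → Fin d → E) :
    divV N R (W - W') = divV N R W - divV N R W' := (divOp N R).map_sub W W'

/-- **THE SLICE SUBSPACE** of `ℓ²` 0-forms: the image `div_R D_R (K)` of a submodule `K` of 0-forms (at the road's data: the kernel of the scalar block
average), read in `PiLp 2` (the `ℓ²` inner product `Σ_x ⟪f x, g x⟫`). [folklore] -/
def sliceSub (R : Tor N → Fin d → (E →L[ℂ] E)) (K : Submodule ℂ (Tor N → E)) : Submodule ℂ (PiLp 2 (fun _ : Tor N => E)) :=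
  (K.map (lapOp N R)).comap (WithLp.linearEquiv 2 ℂ (Tor N → E)).toLinearMap

/-- membership in the slice subspace. [folklore] -/
theorem mem_sliceSub {R : Tor N → Fin d → (E →L[ℂ] E)} {K : Submodule ℂ (Tor N → E)} (v : PiLp 2 (fun _ : Tor N => E)) :
    v ∈ sliceSub N R K ↔ ofLp v ∈ K.map (lapOp N R) := Iff.rfl

/-- `toLp (div_R D_R λ) ∈ sliceSub R K` for `λ ∈ K`. [folklore] -/
theorem toLp_lapOp_mem {R : Tor N → Fin d → (E →L[ℂ] E)} {K : Submodule ℂ (Tor N → E)} {f : Tor N → E} (hf : f ∈ K) :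
    toLp 2 (lapOp N R f) ∈ sliceSub N R K :=
  Submodule.mem_map_of_mem hf

end Linear

/-! ## §3 The projected gauge functional `projG R K W = ‖Π_{div_R D_R (K)} (div_R W)‖²_{ℓ²}` and THE GAUGE MOVE TO ITS ZERO SET (any transports) -/

section Proj

variable [∀ μ, NeZero (N μ)] [InnerProductSpace ℂ E] [CompleteSpace E] [FiniteDimensional ℂ E]

/-- **BAŁABAN's PROJECTED GAUGE FUNCTIONAL in the function world**: `projG R K W := ‖Π_{S_R(K)} (div_R W)‖²` with `Π_S` the `ℓ²`-orthogonal projection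
(`Submodule.starProjection`) onto the slice subspace `S_R(K) = div_R D_R (K)` (finite dimension: the projection exists).  At `R = 1`, `K = ker Q′` this is
`‖(I − P)∂*A‖²` of [Balaban1984PropagatorsI] (1.69)–(1.70) READ through `I − P = Π_{Δ(ker Q′)}` (§5; a reading — the matrix-world bridge to `B5Value126.PcT`
is NOT made here). [folklore] -/
def projG (R : Tor N → Fin d → (E →L[ℂ] E)) (K : Submodule ℂ (Tor N → E)) (W : Tor N → Fin d → E) : ℝ :=
  ‖(sliceSub N R K).starProjection (toLp 2 (divV N R W))‖ ^ 2

/-- (GF0) `0 ≤ projG`. [folklore] -/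
theorem projG_nonneg (R : Tor N → Fin d → (E →L[ℂ] E)) (K : Submodule ℂ (Tor N → E)) (W : Tor N → Fin d → E) :
    0 ≤ projG N R K W := by
  unfold projG; positivity

omit [InnerProductSpace ℂ E] [CompleteSpace E] [FiniteDimensional ℂ E] in
/-- the `ℓ²` norm of a 0-form read in `PiLp 2` is its square sum. [folklore] -/
theorem norm_toLp_sq (f : Tor N → E) : ‖toLp 2 f‖ ^ 2 = ∑ x, ‖f x‖ ^ 2 := by
  rw [PiLp.norm_sq_eq_of_L2]

/-- (GF1)-shape: **`projG R K W ≤ divSq R W`** (an orthogonal projection is a contraction) — hence `≤ d·Σ‖D_μW_ν‖²` by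
`VariationalVectorWeitzenbock.divSq_le_mul_rough` for unitary transports. [folklore] -/
theorem projG_le_divSq (R : Tor N → Fin d → (E →L[ℂ] E)) (K : Submodule ℂ (Tor N → E)) (W : Tor N → Fin d → E) :
    projG N R K W ≤ divSq N R W := by
  unfold projG
  calc ‖(sliceSub N R K).starProjection (toLp 2 (divV N R W))‖ ^ 2 ≤ ‖toLp 2 (divV N R W)‖ ^ 2 :=
        pow_le_pow_left₀ (norm_nonneg _) (Submodule.norm_starProjection_apply_le _ _) 2
    _ = divSq N R W := by rw [norm_toLp_sq]; rfl

/-- `projG` is continuous in the 1-form. [folklore] -/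
theorem continuous_projG (R : Tor N → Fin d → (E →L[ℂ] E)) (K : Submodule ℂ (Tor N → E)) :
    Continuous (projG N R K) := by
  unfold projG
  refine ((((sliceSub N R K).starProjection.continuous).comp ((PiLp.continuous_toLp 2 _).comp ?_)).norm).pow 2
  exact (divOp N R).continuous_of_finiteDimensional

/-- `projG = 0` iff the projected divergence vanishes. [folklore] -/
theorem projG_eq_zero_iff (R : Tor N → Fin d → (E →L[ℂ] E)) (K : Submodule ℂ (Tor N → E)) (W : Tor N → Fin d → E) :
    projG N R K W = 0 ↔ (sliceSub N R K).starProjection (toLp 2 (divV N R W)) = 0 := by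
  unfold projG
  rw [sq_eq_zero_iff, norm_eq_zero]

/-- **THE GAUGE MOVE TO THE SLICE (ANY transports)**: for every 1-form `W` there is `λ ∈ K` with `projG R K (W − D_R λ) = 0` — the projected
divergence `Π_S(div_R W)` lies in `S = div_R D_R (K)`, so it IS `div_R D_R λ` for some `λ ∈ K`, and `div_R (W − D_R λ) = div_R W − Π_S(div_R W) ⊥ S`.
[folklore] -/
theorem exists_gauge_projG_eq_zero (R : Tor N → Fin d → (E →L[ℂ] E)) (K : Submodule ℂ (Tor N → E)) (W : Tor N → Fin d → E) :
    ∃ f ∈ K, projG N R K (W - cDv N R f) = 0 := by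
  set S := sliceSub N R K with hS
  have hmem : S.starProjection (toLp 2 (divV N R W)) ∈ S := S.starProjection_apply_mem _
  rw [mem_sliceSub, Submodule.mem_map] at hmem
  obtain ⟨f, hfK, hf⟩ := hmem
  refine ⟨f, hfK, ?_⟩
  rw [projG_eq_zero_iff, divV_sub, ← lapOp_apply, hf, toLp_sub, toLp_ofLp, map_sub,
    Submodule.starProjection_eq_self_iff.mpr (S.starProjection_apply_mem _)]
  exact sub_self _

/-- the gauge move in the END's letters: the moved field differs from `W` by a covariant gradient of an element of `K` and has `projG = 0`. [folklore] -/
theorem exists_sub_gradient_projG_eq_zero (R : Tor N → Fin d → (E →L[ℂ] E)) (K : Submodule ℂ (Tor N → E)) (W : Tor N → Fin d → E) :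
    ∃ Ws f, f ∈ K ∧ Ws = W - cDv N R f ∧ projG N R K Ws = 0 := by
  obtain ⟨f, hfK, hf⟩ := exists_gauge_projG_eq_zero N R K W
  exact ⟨W - cDv N R f, f, hfK, rfl, hf⟩

/-- **TRANSVERSALITY**: on the gauge directions `D_R λ`, `λ ∈ K`, the projected functional is the FULL divergence form,
`projG R K (D_R λ) = divSq R (D_R λ) = Σ_x ‖(div_R D_R λ)(x)‖²` (the projection fixes `div_R D_R λ ∈ S`). [folklore] -/
theorem projG_gradient_eq_divSq (R : Tor N → Fin d → (E →L[ℂ] E)) {K : Submodule ℂ (Tor N → E)} {f : Tor N → E} (hf : f ∈ K) :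
    projG N R K (cDv N R f) = divSq N R (cDv N R f) := by
  unfold projG
  rw [← lapOp_apply, Submodule.starProjection_eq_self_iff.mpr (toLp_lapOp_mem N hf), norm_toLp_sq]
  rfl

/-- the slice equation: for `λ ∈ K`, `projG R K (W − D_R λ) = 0 ↔ div_R D_R λ = Π_S(div_R W)` (read in `ℓ²`). [folklore] -/
theorem projG_sub_gradient_eq_zero_iff (R : Tor N → Fin d → (E →L[ℂ] E)) {K : Submodule ℂ (Tor N → E)} (W : Tor N → Fin d → E)
    {f : Tor N → E} (hf : f ∈ K) :
    projG N R K (W - cDv N R f) = 0 ↔ toLp 2 (lapOp N R f) = (sliceSub N R K).starProjection (toLp 2 (divV N R W)) := by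
  rw [projG_eq_zero_iff, divV_sub, ← lapOp_apply, toLp_sub, map_sub,
    Submodule.starProjection_eq_self_iff.mpr (toLp_lapOp_mem N hf), sub_eq_zero, eq_comm]

/-- **UNIQUENESS OF THE SLICE POINT MODULO `ker (div_R D_R)|_K`** (any transports): two gauge moves from `K` that both reach the zero set of `projG`
have the same `div_R D_R`-image. [folklore] -/
theorem lapOp_eq_of_projG_eq_zero (R : Tor N → Fin d → (E →L[ℂ] E)) {K : Submodule ℂ (Tor N → E)} (W : Tor N → Fin d → E)
    {f₁ f₂ : Tor N → E} (h₁ : f₁ ∈ K) (h₂ : f₂ ∈ K) (hz₁ : projG N R K (W - cDv N R f₁) = 0) (hz₂ : projG N R K (W - cDv N R f₂) = 0) :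
    lapOp N R f₁ = lapOp N R f₂ := by
  rw [projG_sub_gradient_eq_zero_iff N R W h₁] at hz₁
  rw [projG_sub_gradient_eq_zero_iff N R W h₂] at hz₂
  exact (WithLp.toLp_injective 2) (hz₁.trans hz₂.symm)

omit [∀ μ, NeZero (N μ)] [FiniteDimensional ℂ E] in
/-- the energy identity behind injectivity: `Σ_μ ‖D_μ λ‖²_{ℓ²} = ⟪λ, div_R D_R λ⟫` (colour Bochner adjointness), so **`div_R D_R λ = 0 ⟹ D_R λ = 0`**. [folklore] -/
theorem cDv_eq_zero_of_lapOp_eq_zero [∀ μ, NeZero (N μ)] (R : Tor N → Fin d → (E →L[ℂ] E)) {f : Tor N → E} (h : lapOp N R f = 0)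
    (x : Tor N) (μ : Fin d) : cDv N R f x μ = 0 := by
  have e : ((∑ ν, nsqv N (Dirv N R ν f) : ℝ) : ℂ) = ipv N f (lapOp N R f) := by
    rw [lapOp_eq_negLapv]
    change _ = ipv N f (fun y => ∑ ν, DirAdjv N R ν (Dirv N R ν f) y)
    rw [ipv_sum_right]
    push_cast
    exact sum_congr rfl fun ν _ => by rw [ipv_DirAdjv, ipv_self]
  have h0 : ipv N f (lapOp N R f) = 0 := by
    rw [h]; unfold ipv; simp only [Pi.zero_apply, inner_zero_right, sum_const_zero]
  rw [h0] at e
  have hsum : ∑ ν, nsqv N (Dirv N R ν f) = 0 := by exact_mod_cast e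
  have hμ : nsqv N (Dirv N R μ f) = 0 := (sum_eq_zero_iff_of_nonneg fun ν _ => nsqv_nonneg N _).mp hsum μ (mem_univ μ)
  have hx : ‖Dirv N R μ f x‖ ^ 2 = 0 := (sum_eq_zero_iff_of_nonneg fun y _ => by positivity).mp hμ x (mem_univ x)
  simpa [Dirv] using hx

end Proj

end Summit.QuantumFields.BalabanUV.T4Continuum.VariationalVectorGaugeSlice

end
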